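import Summits.KontsevichZagierPeriods.KontsevichZagierPeriods.Theorems.LiouvilleUnfoldingLogKernelConjectureCensus
import Summits.KontsevichZagierPeriods.KontsevichZagierPeriods.Theorems.LiouvilleUnfoldingLogKernelConjectureCensusRing
import Summits.KontsevichZagierPeriods.KontsevichZagierPeriods.Theorems.LiouvilleUnfoldingAyoubPiLocalKernelNilCut

/-!
# Line `stub_darkTorsion` — skeleton for the OPEN PIECE `stub_darkTorsion` (DT₁) of the crux
# `LiouvilleUnfolding.LogKernelConjecture` (stmt-KontsevichZagierPeriods-2837)

Skeleton registrar (planner, 2026-08-17; "a plan for both sides"). The crux is the summit by name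
(`SpectatorLocalisation.logKernelConjecture_iff_summit`, p95927) and is decomposed by modus ponens as
`LogKernelConjecture ↔ DT₁ ∧ SF₁` (landed exact split `SpectatorLocalisation.stub_split`, p87631; census
part 2 `logKernelConjecture_iff_darkTorsion_and_spectatorFibration`; also `↔ DT₁ ∧ IsDomain P`, census
part 3). The piece `DT₁ = stub_darkTorsion` (registered 2026-08-16, skeleton 437b6b9d; signature copied
VERBATIM into `DarkTorsion` below) had no skeleton of its own. This file is that skeleton.

## The piece

`DT₁` (dark torsion): every formal `ℤ`-combination of integral representations of value `0` becomes a
four-move relation after multiplication by finitely many ONE-DIMENSIONAL representations of non-zero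
value ("good spectators"). In the formal period ring `P := KZ.FormalPeriodRing = FormalRep ⧸ relations`
(`evalP : P →+* ℝ`): `ker evalP` is TORSION for the monoid `S₁` generated by the classes of good
one-dimensional spectators (`LogKernelConjectureCensus.darkTorsion₁_iff_listProd`), i.e. evaluation is
injective on `S₁⁻¹P` — Kontsevich–Zagier's `P̂ = P[1/π]` with every non-zero one-dimensional period
(`π = B(½,½)`, `log 2`, elliptic integrals, …) inverted. Position: `KZ.PiLocalKernel` (item 0541) `→ DT₁`
(`darkTorsion₁_of_piLocalKernel`), summit `→ DT₁`.

## The cut (exact): nilradical cut at the spectator monoid `S₁`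

Replace "`S₁`-torsion" by "`S₁`-locally NILPOTENT" and pay the difference with reducedness of `S₁⁻¹P`:

* `stub_spectatorNilKernel` (N₁, transcendence half): every class of value `0` satisfies
  `(∏ᵢ ⟦sᵢ⟧) · x^(k+1) = 0` for some good one-dimensional `s₁ … s_m` and some `k` — equivalently
  (`spectatorNilKernel_iff_primes`, proved here) EVERY PRIME IDEAL OF `P` AVOIDING ALL GOOD ONE-DIMENSIONAL
  SPECTATOR CLASSES CONTAINS `ker evalP`: every multiplicative move-invariant integration theory with
  values in a domain, in which no non-zero one-dimensional period dies, kills every combination of value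
  `0`. Plan / upstream: implied by the registered stub (N) `stub_nilLocalKernel` of item 0541's live line
  `nilradical-cut` (`spectatorNilKernel_of_piNilKernel`: `⟦[π]⟧ = ⟦[β(½,½)]⟧ ∈ S₁`), hence by
  `KZ.PiLocalKernel` / item 0541 (`spectatorNilKernel_of_piLocalKernel`, `…_of_item0541`). WEAKER than
  (N): only primes avoiding the whole of `S₁` (not just `⟦[π]⟧`) are constrained.
* `stub_spectatorReduced` (R₁, transcendence-free half): an `S₁`-locally nilpotent class is
  `S₁`-torsion — no nilpotents survive in `S₁⁻¹P` among the locally-nil classes. Plan / upstream: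
  implied by `IsReduced P` = item stmt-3929 `FurushoPentagon.ReducedPeriodRing`
  (`spectatorReduced_of_reducedPeriodRing`, with the SAME spectator list), by `IsDomain P`, and by the
  summit; its motivic shadow is Cartier smoothness of the period torsor after localisation
  (HuberMullerStachPeriods2017 Rem. 13.2.4).

`darkTorsion_iff_stubs : DarkTorsion ↔ N₁ ∧ R₁` (exact, proved), `DarkTorsion_of : DarkTorsion` from the
two stubs (sorries ONLY in the two `stub_*`). Neither stub gives `DT₁` or the summit on its own (N₁ needs
reducedness, R₁ needs transcendence; abstractly independent over the bare ring interface, cf. p138786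
for the `⟦π⟧`-version); both are implied by `DT₁` (`stubs_of_darkTorsion`) and by the summit
(`stubs_of_summit`), so a refutation of either refutes `DT₁`, the crux and the summit
(`not_darkTorsion_of_not_…`, `not_summit_of_not_…`).

## Guards (Disproof.lean / Negative/SpectatorEngine read and honoured)

`stubDarkTorsion_false_without_guard` / `stubDarkTorsionWithoutValue_trivial` (Negative/SpectatorEngine):
the kernel guard and the value guard of DT₁ are load-bearing resp. vacuity guards. Same here, proved:
`spectatorNilKernel_false_without_kernel_guard` (drop `evalP x = 0`: false at `x = 1`),
`spectatorReduced_trivial_without_value_guard` (drop `s.value ≠ 0` in the conclusion: the empty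
spectator kills everything), `spectatorReduced_false_without_hyp_guard` (drop it in the hypothesis:
false at `x = 1`). No landed Negative lemma refutes an instance of either stub (Disproof.lean §8: no
torsion / bounded-exponent kill exists; §4/§15: a kill is a `ℚ`-valued exotic invariant — for N₁ it must
moreover be a PRIME, i.e. multiplicative, invariant in which all good one-dimensional spectators survive).

## How the piece plugs into the crux

`logKernelConjecture_of_darkTorsion_of_spectatorFibration : DT₁ → SF₁ → LogKernelConjecture` (census
part 2) and `summit_of_darkTorsion_of_isDomain : DT₁ → IsDomain P → KontsevichZagierPeriods` (part 3).

References: M. Kontsevich, D. Zagier, *Periods* (2001) §1.2 Conjecture 1, §4.1 (`P̂ = P[1/2πi]`);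
J. Ayoub, EMS Newsl. 91 (2014) Def. 6, Conj. 7; A. Huber, S. Müller-Stach, *Periods and Nori Motives*
(2017) Conj. 13.2.1, 13.2.5, Rem. 13.2.4; A. Huber, G. Wüstholz, *Transcendence and linear relations of
1-periods* (2022) App. A.4. Mathlib: `Ideal.exists_le_prime_disjoint`,
`Ideal.IsPrime.multiset_prod_mem_iff_exists_mem`, `IsNilpotent.eq_zero`.
-/

noncomputable section

set_option linter.dupNamespace false

open Literature.NumberTheory.Transcendental

namespace Summit.KontsevichZagierPeriods.KontsevichZagierPeriods.Cruxes.LogKernelConjecture.StubDarkTorsion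

open Summit.KontsevichZagierPeriods.LiouvilleUnfolding.LogKernelConjectureCensus
open Summit.KontsevichZagierPeriods.LiouvilleUnfolding.PiLocalKernelPosition
open Summit.KontsevichZagierPeriods.KontsevichZagierPeriods.BetaCancellationNegative
  (betaHalfRep equivalent_betaHalfRep_piRep betaHalfRep_value)
open Summit.KontsevichZagierPeriods.KontsevichZagierPeriods.ReducedPeriodRingNegative
  (reducedPeriodRing_iff_isReduced isReduced_of_isDomain)

/-! ## The piece, by name (verbatim registered signature of `stub_darkTorsion`) -/

/-- **`DT₁` — the registered stub `stub_darkTorsion` of crux stmt-KontsevichZagierPeriods-2837, verbatim**: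
the kernel of evaluation is torsion for the monoid of good one-dimensional spectators.
OPEN (implied by `KZ.PiLocalKernel`, item 0541, and by the summit). -/
def DarkTorsion : Prop :=
  ∀ c : Literature.NumberTheory.Transcendental.KZ.FormalRep, Literature.NumberTheory.Transcendental.KZ.eval c = 0 → ∃ l : List (Literature.NumberTheory.Transcendental.KZ.IntegralRep 1), (∀ s ∈ l, s.value ≠ 0) ∧ List.foldr (fun s x => Literature.NumberTheory.Transcendental.KZ.of s * x) c l ∈ Literature.NumberTheory.Transcendental.KZ.relations

/-- `DarkTorsion` IS the registered signature (definitional). [folklore] -/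
theorem darkTorsion_iff_registered :
    DarkTorsion ↔
      ∀ c : Literature.NumberTheory.Transcendental.KZ.FormalRep, Literature.NumberTheory.Transcendental.KZ.eval c = 0 → ∃ l : List (Literature.NumberTheory.Transcendental.KZ.IntegralRep 1), (∀ s ∈ l, s.value ≠ 0) ∧ List.foldr (fun s x => Literature.NumberTheory.Transcendental.KZ.of s * x) c l ∈ Literature.NumberTheory.Transcendental.KZ.relations :=
  Iff.rfl

/-! ## The two stubs (registered signatures; closed form over tree declarations) -/

/-- **Stub 1 — `SpectatorNilKernel` (N₁, transcendence half).** Every formal period of value `0` is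
nilpotent after inverting the good one-dimensional spectators: `(∏ᵢ ⟦sᵢ⟧) * x ^ (k + 1) = 0` for some
one-dimensional `sᵢ` of non-zero value and some `k`. Prime form: every prime of `P` avoiding all good
one-dimensional spectator classes contains `ker evalP` (`spectatorNilKernel_iff_primes`). Summit-implied;
implied by item 0541's stub (N). OPEN — period-conjecture strength (Ayoub2014 Conj. 7 localised further,
minus reducedness). -/
theorem stub_spectatorNilKernel :
    ∀ x : Literature.NumberTheory.Transcendental.KZ.FormalPeriodRing,
      Literature.NumberTheory.Transcendental.KZ.evalP x = 0 →
        ∃ (l : List (Literature.NumberTheory.Transcendental.KZ.IntegralRep 1)) (k : ℕ),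
          (∀ s ∈ l, s.value ≠ 0) ∧
            (l.map fun s => Literature.NumberTheory.Transcendental.KZ.toFormalPeriod
              (Literature.NumberTheory.Transcendental.KZ.of s)).prod * x ^ (k + 1) = 0 := by
  sorry

/-- **Stub 2 — `SpectatorReduced` (R₁, transcendence-free half).** A class killed, up to a power, by a
product of good one-dimensional spectators is killed outright by such a product: the localisation
`S₁⁻¹P` has no nilpotents among the `S₁`-locally nil classes. Implied by `IsReduced P` (item stmt-3929
`ReducedPeriodRing`, same list), by `IsDomain P`, by the summit. OPEN for the four-move calculus. -/
theorem stub_spectatorReduced :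
    ∀ x : Literature.NumberTheory.Transcendental.KZ.FormalPeriodRing,
      (∃ (l : List (Literature.NumberTheory.Transcendental.KZ.IntegralRep 1)) (k : ℕ),
          (∀ s ∈ l, s.value ≠ 0) ∧
            (l.map fun s => Literature.NumberTheory.Transcendental.KZ.toFormalPeriod
              (Literature.NumberTheory.Transcendental.KZ.of s)).prod * x ^ (k + 1) = 0) →
        ∃ l : List (Literature.NumberTheory.Transcendental.KZ.IntegralRep 1),
          (∀ s ∈ l, s.value ≠ 0) ∧
            (l.map fun s => Literature.NumberTheory.Transcendental.KZ.toFormalPeriod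
              (Literature.NumberTheory.Transcendental.KZ.of s)).prod * x = 0 := by
  sorry

/-! ## Soundness in nil form and exactness of the cut -/

/-- If `(∏ᵢ ⟦sᵢ⟧) * x ^ (k + 1) = 0` with all `sᵢ.value ≠ 0` then `evalP x = 0` (`evalP` is a ring map to
the domain `ℝ` and the product evaluates to `∏ᵢ sᵢ.value ≠ 0`). [folklore] -/
theorem evalP_eq_zero_of_listProd_mul_pow_succ_eq_zero {x : KZ.FormalPeriodRing}
    {l : List (KZ.IntegralRep 1)} {k : ℕ} (hl : ∀ s ∈ l, s.value ≠ 0)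
    (h : (l.map fun s => KZ.toFormalPeriod (KZ.of s)).prod * x ^ (k + 1) = 0) : KZ.evalP x = 0 := by
  have h' := congrArg KZ.evalP h
  rw [map_mul, map_pow, map_zero] at h'
  exact (pow_eq_zero_iff (Nat.succ_ne_zero k)).mp
    ((mul_eq_zero.mp h').resolve_left (evalP_listProd_ne_zero hl))

/-- **The cut is exact**: `DT₁ ↔ N₁ ∧ R₁`. `→`: in ring form (`darkTorsion₁_iff_listProd`) the torsion
statement is the nil statement with `k = 0`, and an `S₁`-locally nil class has value `0`, so `DT₁` applies
to it. `←`: compose. [folklore] -/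
theorem darkTorsion_iff_stubs :
    DarkTorsion ↔
      ((∀ x : KZ.FormalPeriodRing, KZ.evalP x = 0 →
          ∃ (l : List (KZ.IntegralRep 1)) (k : ℕ), (∀ s ∈ l, s.value ≠ 0) ∧
            (l.map fun s => KZ.toFormalPeriod (KZ.of s)).prod * x ^ (k + 1) = 0) ∧
        (∀ x : KZ.FormalPeriodRing,
          (∃ (l : List (KZ.IntegralRep 1)) (k : ℕ), (∀ s ∈ l, s.value ≠ 0) ∧
              (l.map fun s => KZ.toFormalPeriod (KZ.of s)).prod * x ^ (k + 1) = 0) →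
            ∃ l : List (KZ.IntegralRep 1), (∀ s ∈ l, s.value ≠ 0) ∧
              (l.map fun s => KZ.toFormalPeriod (KZ.of s)).prod * x = 0)) := by
  rw [darkTorsion_iff_registered, darkTorsion₁_iff_listProd]
  constructor
  · intro h
    refine ⟨fun x hx => ?_, fun x ⟨l, k, hl, hlk⟩ =>
      h x (evalP_eq_zero_of_listProd_mul_pow_succ_eq_zero hl hlk)⟩
    obtain ⟨l, hl, hlx⟩ := h x hx
    exact ⟨l, 0, hl, by rw [zero_add, pow_one]; exact hlx⟩
  · rintro ⟨hnil, hred⟩ x hx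
    exact hred x (hnil x hx)

/-! ## Composition: the piece BY NAME from the two stubs -/

/-- **The line's deciding step**: the two stubs prove the piece `DarkTorsion` (= `stub_darkTorsion`)
BY NAME. [folklore] -/
theorem DarkTorsion_of : DarkTorsion :=
  darkTorsion_iff_stubs.mpr ⟨stub_spectatorNilKernel, stub_spectatorReduced⟩

/-! ## Each stub against the tree: the plans for both halves -/

/-- `⟦[β(½,½)]⟧ = ⟦[π]⟧` in `P`: the disc class IS a good one-dimensional spectator class
(`equivalent_betaHalfRep_piRep`, value `π ≠ 0`). [cite: KontsevichZagier2001, §1.1] -/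
theorem betaHalfClass_eq_piClass :
    KZ.toFormalPeriod (KZ.of betaHalfRep) = KZ.toFormalPeriod (KZ.of KZ.piRep) :=
  KZ.Equivalent.toFormalPeriod_eq equivalent_betaHalfRep_piRep

/-- **Item 0541's registered stub (N) implies stub 1**: a `⟦π⟧`-locally nilpotent class is `S₁`-locally
nilpotent, with the spectator list `[β(½,½)] × N`. So N₁ is AT MOST as strong as the transcendence half
of the live line `nilradical-cut` of crux 0541. [folklore] -/
theorem spectatorNilKernel_of_piNilKernel
    (hN : ∀ x : KZ.FormalPeriodRing, KZ.evalP x = 0 →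
      ∃ N k : ℕ, KZ.toFormalPeriod (KZ.of KZ.piRep) ^ N * x ^ (k + 1) = 0) :
    ∀ x : KZ.FormalPeriodRing, KZ.evalP x = 0 →
      ∃ (l : List (KZ.IntegralRep 1)) (k : ℕ), (∀ s ∈ l, s.value ≠ 0) ∧
        (l.map fun s => KZ.toFormalPeriod (KZ.of s)).prod * x ^ (k + 1) = 0 := by
  intro x hx
  obtain ⟨N, k, hNk⟩ := hN x hx
  refine ⟨List.replicate N betaHalfRep, k, ?_, ?_⟩
  · intro s hs
    rw [List.eq_of_mem_replicate hs, betaHalfRep_value]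
    exact Real.pi_ne_zero
  · rw [List.map_replicate, List.prod_replicate, betaHalfClass_eq_piClass]
    exact hNk

/-- **`KZ.PiLocalKernel → N₁`** (`N`-th power of the disc, exponent `k = 0`). [folklore] -/
theorem spectatorNilKernel_of_piLocalKernel (h : KZ.PiLocalKernel) :
    ∀ x : KZ.FormalPeriodRing, KZ.evalP x = 0 →
      ∃ (l : List (KZ.IntegralRep 1)) (k : ℕ), (∀ s ∈ l, s.value ≠ 0) ∧
        (l.map fun s => KZ.toFormalPeriod (KZ.of s)).prod * x ^ (k + 1) = 0 :=
  spectatorNilKernel_of_piNilKernel fun x hx => by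
    obtain ⟨N, hN⟩ := (piLocalKernel_iff_forall_evalP.mp h) x hx
    exact ⟨N, 0, by rw [zero_add, pow_one]; exact hN⟩

/-- **Item stmt-0541 (`LiouvilleUnfolding.AyoubPiLocalKernel`) implies stub 1.** [folklore] -/
theorem spectatorNilKernel_of_item0541
    (h : Summit.KontsevichZagierPeriods.KontsevichZagierPeriods.Theses.LiouvilleUnfolding.AyoubPiLocalKernel) :
    ∀ x : KZ.FormalPeriodRing, KZ.evalP x = 0 →
      ∃ (l : List (KZ.IntegralRep 1)) (k : ℕ), (∀ s ∈ l, s.value ≠ 0) ∧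
        (l.map fun s => KZ.toFormalPeriod (KZ.of s)).prod * x ^ (k + 1) = 0 :=
  spectatorNilKernel_of_piLocalKernel (ayoubPiLocalKernel_iff_piLocalKernel.mp h)

/-- **`IsReduced P` implies stub 2** with the same spectator list: from `u * x ^ (k+1) = 0`,
`(u * x) ^ (k+1) = u ^ k * (u * x ^ (k+1)) = 0`, so `u * x` is nilpotent, hence `0`. [folklore] -/
theorem spectatorReduced_of_isReduced (hred : IsReduced KZ.FormalPeriodRing) :
    ∀ x : KZ.FormalPeriodRing,
      (∃ (l : List (KZ.IntegralRep 1)) (k : ℕ), (∀ s ∈ l, s.value ≠ 0) ∧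
          (l.map fun s => KZ.toFormalPeriod (KZ.of s)).prod * x ^ (k + 1) = 0) →
        ∃ l : List (KZ.IntegralRep 1), (∀ s ∈ l, s.value ≠ 0) ∧
          (l.map fun s => KZ.toFormalPeriod (KZ.of s)).prod * x = 0 := by
  rintro x ⟨l, k, hl, hlk⟩
  refine ⟨l, hl, ?_⟩
  haveI := hred
  set u := (l.map fun s => KZ.toFormalPeriod (KZ.of s)).prod with hu
  have hnil : IsNilpotent (u * x) :=
    ⟨k + 1, by rw [mul_pow, pow_succ, mul_assoc, hlk, mul_zero]⟩
  exact hnil.eq_zero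

/-- **Item stmt-3929 (`FurushoPentagon.ReducedPeriodRing`) implies stub 2.** [folklore] -/
theorem spectatorReduced_of_reducedPeriodRing
    (h : Summit.KontsevichZagierPeriods.KontsevichZagierPeriods.Theses.FurushoPentagon.ReducedPeriodRing) :
    ∀ x : KZ.FormalPeriodRing,
      (∃ (l : List (KZ.IntegralRep 1)) (k : ℕ), (∀ s ∈ l, s.value ≠ 0) ∧
          (l.map fun s => KZ.toFormalPeriod (KZ.of s)).prod * x ^ (k + 1) = 0) →
        ∃ l : List (KZ.IntegralRep 1), (∀ s ∈ l, s.value ≠ 0) ∧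
          (l.map fun s => KZ.toFormalPeriod (KZ.of s)).prod * x = 0 :=
  spectatorReduced_of_isReduced (reducedPeriodRing_iff_isReduced.mp h)

/-- `IsDomain P` implies stub 2 (a domain is reduced). [folklore] -/
theorem spectatorReduced_of_isDomain (h : IsDomain KZ.FormalPeriodRing) :
    ∀ x : KZ.FormalPeriodRing,
      (∃ (l : List (KZ.IntegralRep 1)) (k : ℕ), (∀ s ∈ l, s.value ≠ 0) ∧
          (l.map fun s => KZ.toFormalPeriod (KZ.of s)).prod * x ^ (k + 1) = 0) →
        ∃ l : List (KZ.IntegralRep 1), (∀ s ∈ l, s.value ≠ 0) ∧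
          (l.map fun s => KZ.toFormalPeriod (KZ.of s)).prod * x = 0 :=
  spectatorReduced_of_isReduced (isReduced_of_isDomain h)

/-- Both stubs follow from the piece (exactness, forward direction; `DT₁` inlined as registered). [folklore] -/
theorem stubs_of_darkTorsion
    (h : ∀ c : KZ.FormalRep, KZ.eval c = 0 → ∃ l : List (KZ.IntegralRep 1), (∀ s ∈ l, s.value ≠ 0) ∧
      List.foldr (fun s x => KZ.of s * x) c l ∈ KZ.relations) :
    (∀ x : KZ.FormalPeriodRing, KZ.evalP x = 0 →
        ∃ (l : List (KZ.IntegralRep 1)) (k : ℕ), (∀ s ∈ l, s.value ≠ 0) ∧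
          (l.map fun s => KZ.toFormalPeriod (KZ.of s)).prod * x ^ (k + 1) = 0) ∧
      (∀ x : KZ.FormalPeriodRing,
        (∃ (l : List (KZ.IntegralRep 1)) (k : ℕ), (∀ s ∈ l, s.value ≠ 0) ∧
            (l.map fun s => KZ.toFormalPeriod (KZ.of s)).prod * x ^ (k + 1) = 0) →
          ∃ l : List (KZ.IntegralRep 1), (∀ s ∈ l, s.value ≠ 0) ∧
            (l.map fun s => KZ.toFormalPeriod (KZ.of s)).prod * x = 0) :=
  darkTorsion_iff_stubs.mp h

/-- Both stubs follow from the summit (`summit ↔ DT₁ ∧ IsDomain P`, census part 3): neither is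
refutable short of refuting the Kontsevich–Zagier period conjecture. [folklore] -/
theorem stubs_of_summit (h : KontsevichZagierPeriods) :
    (∀ x : KZ.FormalPeriodRing, KZ.evalP x = 0 →
        ∃ (l : List (KZ.IntegralRep 1)) (k : ℕ), (∀ s ∈ l, s.value ≠ 0) ∧
          (l.map fun s => KZ.toFormalPeriod (KZ.of s)).prod * x ^ (k + 1) = 0) ∧
      (∀ x : KZ.FormalPeriodRing,
        (∃ (l : List (KZ.IntegralRep 1)) (k : ℕ), (∀ s ∈ l, s.value ≠ 0) ∧
            (l.map fun s => KZ.toFormalPeriod (KZ.of s)).prod * x ^ (k + 1) = 0) →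
          ∃ l : List (KZ.IntegralRep 1), (∀ s ∈ l, s.value ≠ 0) ∧
            (l.map fun s => KZ.toFormalPeriod (KZ.of s)).prod * x = 0) :=
  darkTorsion_iff_stubs.mp (summit_iff_darkTorsion₁_and_isDomain.mp h).1

/-! ## Negative hooks -/

/-- A refutation of stub 1 refutes the piece. [folklore] -/
theorem not_darkTorsion_of_not_spectatorNilKernel
    (h : ¬ ∀ x : KZ.FormalPeriodRing, KZ.evalP x = 0 →
      ∃ (l : List (KZ.IntegralRep 1)) (k : ℕ), (∀ s ∈ l, s.value ≠ 0) ∧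
        (l.map fun s => KZ.toFormalPeriod (KZ.of s)).prod * x ^ (k + 1) = 0) :
    ¬ ∀ c : KZ.FormalRep, KZ.eval c = 0 → ∃ l : List (KZ.IntegralRep 1), (∀ s ∈ l, s.value ≠ 0) ∧
      List.foldr (fun s x => KZ.of s * x) c l ∈ KZ.relations :=
  fun hD => h (stubs_of_darkTorsion hD).1

/-- A refutation of stub 2 refutes the piece. [folklore] -/
theorem not_darkTorsion_of_not_spectatorReduced
    (h : ¬ ∀ x : KZ.FormalPeriodRing,
      (∃ (l : List (KZ.IntegralRep 1)) (k : ℕ), (∀ s ∈ l, s.value ≠ 0) ∧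
          (l.map fun s => KZ.toFormalPeriod (KZ.of s)).prod * x ^ (k + 1) = 0) →
        ∃ l : List (KZ.IntegralRep 1), (∀ s ∈ l, s.value ≠ 0) ∧
          (l.map fun s => KZ.toFormalPeriod (KZ.of s)).prod * x = 0) :
    ¬ ∀ c : KZ.FormalRep, KZ.eval c = 0 → ∃ l : List (KZ.IntegralRep 1), (∀ s ∈ l, s.value ≠ 0) ∧
      List.foldr (fun s x => KZ.of s * x) c l ∈ KZ.relations :=
  fun hD => h (stubs_of_darkTorsion hD).2

/-- A refutation of stub 2 — a nilpotent of `S₁⁻¹P` among the locally-nil classes — refutes the summit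
(and item 3929). [folklore] -/
theorem not_summit_of_not_spectatorReduced
    (h : ¬ ∀ x : KZ.FormalPeriodRing,
      (∃ (l : List (KZ.IntegralRep 1)) (k : ℕ), (∀ s ∈ l, s.value ≠ 0) ∧
          (l.map fun s => KZ.toFormalPeriod (KZ.of s)).prod * x ^ (k + 1) = 0) →
        ∃ l : List (KZ.IntegralRep 1), (∀ s ∈ l, s.value ≠ 0) ∧
          (l.map fun s => KZ.toFormalPeriod (KZ.of s)).prod * x = 0) :
    ¬ KontsevichZagierPeriods :=
  fun hS => h (stubs_of_summit hS).2

/-- A refutation of stub 1 — a prime of `P` avoiding all good one-dimensional spectators but not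
containing `ker evalP` — refutes the summit (and item 0541). [folklore] -/
theorem not_summit_of_not_spectatorNilKernel
    (h : ¬ ∀ x : KZ.FormalPeriodRing, KZ.evalP x = 0 →
      ∃ (l : List (KZ.IntegralRep 1)) (k : ℕ), (∀ s ∈ l, s.value ≠ 0) ∧
        (l.map fun s => KZ.toFormalPeriod (KZ.of s)).prod * x ^ (k + 1) = 0) :
    ¬ KontsevichZagierPeriods :=
  fun hS => h (stubs_of_summit hS).1

/-! ## Stub 1 on the prime spectrum -/

/-- A product of a list lies in a prime ideal only if some member does. [folklore] -/
theorem exists_mem_of_list_prod_mem {R : Type*} [CommRing R] {q : Ideal R} (hq : q.IsPrime)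
    {L : List R} (h : L.prod ∈ q) : ∃ p ∈ L, p ∈ q := by
  have h' : ((L : Multiset R)).prod ∈ q := by rwa [Multiset.prod_coe]
  obtain ⟨p, hp, hpq⟩ := (hq.multiset_prod_mem_iff_exists_mem _).mp h'
  exact ⟨p, Multiset.mem_coe.mp hp, hpq⟩

/-- **Prime-ideal form of stub 1.** N₁ holds iff every prime ideal of `P` which contains NO class of a
one-dimensional representation of non-zero value contains the value-kernel. `→`: from
`(∏ᵢ ⟦sᵢ⟧) * x ^ (k+1) = 0 ∈ q`. `←`: if no `(∏ᵢ ⟦sᵢ⟧) * x ^ (b+1)` vanishes, the multiplicative set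
`{(∏ᵢ ⟦sᵢ⟧) * x ^ b}` avoids `0`, so some prime avoids it (`Ideal.exists_le_prime_disjoint`); that prime
avoids every good spectator and `x`, contradiction. The object a disprover must exhibit: a domain-valued
multiplicative, move-invariant integration theory in which every non-zero one-dimensional period
survives and some combination of value `0` does not die. [cite: HuberMullerStachPeriods2017, Conj. 13.2.5] -/
theorem spectatorNilKernel_iff_primes :
    (∀ x : KZ.FormalPeriodRing, KZ.evalP x = 0 →
        ∃ (l : List (KZ.IntegralRep 1)) (k : ℕ), (∀ s ∈ l, s.value ≠ 0) ∧
          (l.map fun s => KZ.toFormalPeriod (KZ.of s)).prod * x ^ (k + 1) = 0) ↔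
      ∀ q : Ideal KZ.FormalPeriodRing, q.IsPrime →
        (∀ s : KZ.IntegralRep 1, s.value ≠ 0 → KZ.toFormalPeriod (KZ.of s) ∉ q) →
          RingHom.ker KZ.evalP ≤ q := by
  constructor
  · intro h q hq hS x hx
    obtain ⟨l, k, hl, hlk⟩ := h x (RingHom.mem_ker.mp hx)
    have hmem : (l.map fun s => KZ.toFormalPeriod (KZ.of s)).prod * x ^ (k + 1) ∈ q := by
      rw [hlk]; exact q.zero_mem
    rcases hq.mem_or_mem hmem with h1 | h2
    · exfalso
      obtain ⟨p, hp, hpq⟩ := exists_mem_of_list_prod_mem hq h1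
      obtain ⟨s, hs, rfl⟩ := List.mem_map.mp hp
      exact hS s (hl s hs) hpq
    · exact hq.mem_of_pow_mem (k + 1) h2
  · intro h x hx
    by_contra hcon
    push Not at hcon
    let f : KZ.IntegralRep 1 → KZ.FormalPeriodRing := fun s => KZ.toFormalPeriod (KZ.of s)
    let M : Submonoid KZ.FormalPeriodRing :=
      { carrier := {y | ∃ (l : List (KZ.IntegralRep 1)) (b : ℕ), (∀ s ∈ l, s.value ≠ 0) ∧
          y = (l.map f).prod * x ^ b}
        mul_mem' := by
          rintro _ _ ⟨l₁, b₁, hl₁, rfl⟩ ⟨l₂, b₂, hl₂, rfl⟩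
          refine ⟨l₁ ++ l₂, b₁ + b₂, ?_, ?_⟩
          · intro s hs
            rcases List.mem_append.mp hs with h₁ | h₂
            · exact hl₁ s h₁
            · exact hl₂ s h₂
          · rw [List.map_append, List.prod_append, pow_add]; ring
        one_mem' := ⟨[], 0, by simp, by simp⟩ }
    have h0 : (0 : KZ.FormalPeriodRing) ∉ M := by
      rintro ⟨l, b, hl, hb⟩
      cases b with
      | zero => exact listProd_ne_zero hl (by simpa using hb.symm)
      | succ k => exact hcon l k hl hb.symm
    have hdisj : Disjoint ((⊥ : Ideal KZ.FormalPeriodRing) : Set KZ.FormalPeriodRing) M := by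
      rw [Set.disjoint_left]
      intro y hy hyM
      rw [SetLike.mem_coe, Ideal.mem_bot] at hy
      subst hy
      exact h0 hyM
    obtain ⟨q, hq, -, hqM⟩ := Ideal.exists_le_prime_disjoint (⊥ : Ideal KZ.FormalPeriodRing) M hdisj
    have hS : ∀ s : KZ.IntegralRep 1, s.value ≠ 0 → KZ.toFormalPeriod (KZ.of s) ∉ q := by
      intro s hs hsq
      refine Set.disjoint_left.mp hqM hsq ⟨[s], 0, ?_, ?_⟩
      · intro t ht
        rw [List.mem_singleton.mp ht]; exact hs
      · simp [f]
    have hxq : x ∉ q := fun hxq' => Set.disjoint_left.mp hqM hxq' ⟨[], 1, by simp, by simp⟩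
    exact hxq (h q hq hS (RingHom.mem_ker.mpr hx))

/-! ## Guards are load-bearing (the line honours Negative/SpectatorEngine) -/

/-- **Stub 1 without its kernel guard is FALSE**: at `x = 1` it asks for `∏ᵢ ⟦sᵢ⟧ = 0` with all
`sᵢ.value ≠ 0`, but such a product evaluates to `∏ᵢ sᵢ.value ≠ 0` (cf.
`stubDarkTorsion_false_without_guard`). [folklore] -/
theorem spectatorNilKernel_false_without_kernel_guard :
    ¬ ∀ x : KZ.FormalPeriodRing,
        ∃ (l : List (KZ.IntegralRep 1)) (k : ℕ), (∀ s ∈ l, s.value ≠ 0) ∧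
          (l.map fun s => KZ.toFormalPeriod (KZ.of s)).prod * x ^ (k + 1) = 0 := by
  intro h
  obtain ⟨l, k, hl, hlk⟩ := h 1
  rw [one_pow, mul_one] at hlk
  exact listProd_ne_zero hl hlk

/-- **Stub 2 without the value guard in its conclusion is TRIVIALLY TRUE**: the empty one-dimensional
spectator `[∅, 0]` is a relation, so its class kills every formal period (cf.
`stubDarkTorsionWithoutValue_trivial`). [folklore] -/
theorem spectatorReduced_trivial_without_value_guard (x : KZ.FormalPeriodRing) :
    ∃ l : List (KZ.IntegralRep 1), (l.map fun s => KZ.toFormalPeriod (KZ.of s)).prod * x = 0 :=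
  ⟨[KZ.IntegralRep.empty 1], by
    rw [List.map_singleton, List.prod_singleton,
      KZ.toFormalPeriod_eq_zero_of_mem KZ.IntegralRep.of_empty_mem_relations, zero_mul]⟩

/-- **Stub 2 without the value guard in its hypothesis is FALSE**: the empty spectator makes the
hypothesis hold at `x = 1`, where the guarded conclusion fails. [folklore] -/
theorem spectatorReduced_false_without_hyp_guard :
    ¬ ∀ x : KZ.FormalPeriodRing,
        (∃ (l : List (KZ.IntegralRep 1)) (k : ℕ),
            (l.map fun s => KZ.toFormalPeriod (KZ.of s)).prod * x ^ (k + 1) = 0) →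
          ∃ l : List (KZ.IntegralRep 1), (∀ s ∈ l, s.value ≠ 0) ∧
            (l.map fun s => KZ.toFormalPeriod (KZ.of s)).prod * x = 0 := by
  intro h
  obtain ⟨l, hl, hl1⟩ := h 1 ⟨[KZ.IntegralRep.empty 1], 0, by
    rw [List.map_singleton, List.prod_singleton,
      KZ.toFormalPeriod_eq_zero_of_mem KZ.IntegralRep.of_empty_mem_relations, zero_mul]⟩
  rw [mul_one] at hl1
  exact listProd_ne_zero hl hl1

/-! ## How the piece plugs into the crux and the summit -/

/-- **`DT₁ → SF₁ → LogKernelConjecture`**: the modus-ponens join of the crux (census part 2,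
`logKernelConjecture_iff_darkTorsion_and_spectatorFibration`; both registered signatures inlined). [folklore] -/
theorem logKernelConjecture_of_darkTorsion_of_spectatorFibration
    (hD : ∀ c : Literature.NumberTheory.Transcendental.KZ.FormalRep,
      Literature.NumberTheory.Transcendental.KZ.eval c = 0 →
        ∃ l : List (Literature.NumberTheory.Transcendental.KZ.IntegralRep 1),
          (∀ s ∈ l, s.value ≠ 0) ∧
            List.foldr (fun s x => Literature.NumberTheory.Transcendental.KZ.of s * x) c l ∈
              Literature.NumberTheory.Transcendental.KZ.relations)
    (hF : ∀ (s : Literature.NumberTheory.Transcendental.KZ.IntegralRep 1)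
      (c : Literature.NumberTheory.Transcendental.KZ.FormalRep), s.value ≠ 0 →
        Literature.NumberTheory.Transcendental.KZ.of s * c ∈
          Literature.NumberTheory.Transcendental.KZ.relations →
          ∃ c' : Literature.NumberTheory.Transcendental.KZ.FormalRep,
            c - c' ∈ Literature.NumberTheory.Transcendental.KZ.relations ∧
              Literature.NumberTheory.Transcendental.KZ.of s * c' ∈
                Literature.NumberTheory.Transcendental.KZ.fibredRelations) :
    Summit.KontsevichZagierPeriods.KontsevichZagierPeriods.Theses.LiouvilleUnfolding.LogKernelConjecture :=
  logKernelConjecture_iff_darkTorsion_and_spectatorFibration.mpr ⟨hD, hF⟩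

/-- **`DT₁ → IsDomain P → KontsevichZagierPeriods`** (census part 3). [folklore] -/
theorem summit_of_darkTorsion_of_isDomain
    (hD : ∀ c : KZ.FormalRep, KZ.eval c = 0 → ∃ l : List (KZ.IntegralRep 1), (∀ s ∈ l, s.value ≠ 0) ∧
      List.foldr (fun s x => KZ.of s * x) c l ∈ KZ.relations)
    (hdom : IsDomain KZ.FormalPeriodRing) : KontsevichZagierPeriods :=
  summit_iff_darkTorsion₁_and_isDomain.mpr ⟨hD, hdom⟩

/-- **The whole two-layer tree as one term**: N₁ → R₁ → SF₁ → `LogKernelConjecture`. [folklore] -/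
theorem logKernelConjecture_of_stubs_of_spectatorFibration
    (hN : ∀ x : KZ.FormalPeriodRing, KZ.evalP x = 0 →
      ∃ (l : List (KZ.IntegralRep 1)) (k : ℕ), (∀ s ∈ l, s.value ≠ 0) ∧
        (l.map fun s => KZ.toFormalPeriod (KZ.of s)).prod * x ^ (k + 1) = 0)
    (hR : ∀ x : KZ.FormalPeriodRing,
      (∃ (l : List (KZ.IntegralRep 1)) (k : ℕ), (∀ s ∈ l, s.value ≠ 0) ∧
          (l.map fun s => KZ.toFormalPeriod (KZ.of s)).prod * x ^ (k + 1) = 0) →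
        ∃ l : List (KZ.IntegralRep 1), (∀ s ∈ l, s.value ≠ 0) ∧
          (l.map fun s => KZ.toFormalPeriod (KZ.of s)).prod * x = 0)
    (hF : ∀ (s : KZ.IntegralRep 1) (c : KZ.FormalRep), s.value ≠ 0 → KZ.of s * c ∈ KZ.relations →
      ∃ c' : KZ.FormalRep, c - c' ∈ KZ.relations ∧ KZ.of s * c' ∈ KZ.fibredRelations) :
    Summit.KontsevichZagierPeriods.KontsevichZagierPeriods.Theses.LiouvilleUnfolding.LogKernelConjecture :=
  logKernelConjecture_of_darkTorsion_of_spectatorFibration (darkTorsion_iff_stubs.mpr ⟨hN, hR⟩) hF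

end Summit.KontsevichZagierPeriods.KontsevichZagierPeriods.Cruxes.LogKernelConjecture.StubDarkTorsion

end
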